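import Summits.NavierStokesRegularity.NavierStokesRegularity.Theorems.HubbleDynamoNoSelfExcitedDynamoEquivalence
import Summits.NavierStokesRegularity.NavierStokesRegularity.Theorems.HubbleDynamoNoSelfExcitedDynamoStubPastShift
import Summits.NavierStokesRegularity.NavierStokesRegularity.Theorems.HubbleDynamoNoSelfExcitedDynamoStubForwardVanishing
import Summits.NavierStokesRegularity.NavierStokesRegularity.Theorems.HubbleDynamoNoSelfExcitedDynamoHardness
import Summits.NavierStokesRegularity.NavierStokesRegularity.Theorems.QuantisedSymmetryPolyhedralDssProfileExistsStubNoLargeScaleNullSlice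
import Literature.Analysis.FluidPDE.AncientWeakL3BackwardLiouvilleHolds
import HarnessLib

/-!
# Crux `NoSelfExcitedDynamo` (stmt-NavierStokesRegularity-1934), line `registered` (v17):
# stub `stub_farFieldTransfer` — the far-field rung

Theorems file (`--supports stmt-NavierStokesRegularity-1934`; theorems only, sorry-free). Let `(W, Q)`
be an ETERNAL classical solution of Leray's backward system
`∂ₛW + ½W + ½(y·∇)W + (W·∇)W + ∇Q = ΔW`, `div W = 0` on `ℝ × ℝ³` (`IsBackwardLeraySolutionOn univ 1 W Q`)
in the uniform profile class `(1 + ‖y‖)^{k+1} ‖DᵏW(s, ·)(y)‖ ≤ K_k`. If ONE slice `W(s₀)` has trivial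
blow-down at spatial infinity — `λ W(s₀)(λ ·) ⇀ 0` in `𝒟'` as `λ → +∞` (Navier–Stokes rescaling tested
against smooth compactly supported fields) — then `W ≡ 0`.

## Proof

This is Albritton–Barker 2019, Thm 4.1 (`ε = 0`; J. Math. Fluid Mech. 21 (2019) = arXiv:1811.00502,
§4), the tree THEOREM `AlbrittonBarker2019_liouville_weakL3_backward_holds`, applied to the physical
field of the profile shifted into the past.

* `farField_liouville_physical` (the physical form of the rung): a classical unforced Navier–Stokes
  solution `v` on `(−∞, 0) × ℝ³` which is bounded, has the pointwise Type-I bound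
  `‖v(t, x)‖ ≤ K₀/(‖x‖ + √(−t))`, and has ONE slice `v(t₀)`, `t₀ < 0`, with trivial blow-down vanishes
  for `t ≤ t₀`. Indeed `v` is in the bounded Oseen integral-equation class (continuity; weakly
  divergence-free slices; the Oseen identity between all pairs of negative times by KNSS 2009,
  Thm 6.1, mildness clause, `KNSS2009_mild_of_rMulNorm_bounded_holds`, on the windows `(s − 1, 0)`
  from the sup bound and `r‖v‖ ≤ K₀`); the Type-I bound gives the uniform weak-`L³` bound
  `s³ · vol{s < |v(τ)|} ≤ K₀³ |B₁|` at every negative time (`s < K₀/(‖x‖ + √(−τ))` forces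
  `‖x‖ < K₀/s`) and the heat-kernel `Ḃ^{-1}_{∞,∞}` bound of the final slice
  (`sqrt_mul_norm_heatExtension_le_of_norm_le_div`, from `‖v(t₀, z)‖ ≤ K₀/‖z‖`); Albritton–Barker's
  theorem concludes.
* `stub_farFieldTransfer`: for the profile `W`, the physical field `u = ofLerayOrbit W` has the Type-I
  bound with the `k = 0` profile constant (`hasTypeIDecay_iff_lerayOrbit`); its past shift
  `v(t) = u(t − τ)`, `τ = e^{−s₀}/2`, is classical on `(−∞, 0)` (`pastShift_isClassicalNSSolutionOn`),
  bounded (`hardness_isBoundedOn_translate`) and Type-I (`hardness_hasTypeIDecay_translate`), and its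
  slice `v(−τ) = u(−e^{−s₀}) = a⁻¹ W(s₀)(a⁻¹ ·)`, `a = e^{−s₀/2}`, inherits the trivial blow-down
  (reparametrise `λ ↦ λ a⁻¹ → +∞`). So `v ≡ 0` for `t ≤ −τ`, i.e. `u(t) ≡ 0` for `t ≤ −e^{−s₀}`, i.e.
  `W(s) ≡ 0` for `s ≤ s₀`; the landed forward uniqueness `stub_forwardVanishing` gives `W ≡ 0`.
-/

noncomputable section

-- the mandated stub namespace repeats `NavierStokesRegularity` (tree precedent for this crux's stubs)
set_option linter.dupNamespace false

namespace Summit.NavierStokesRegularity.NavierStokesRegularity.Theorems.NoSelfExcitedDynamo.Registered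

open Set MeasureTheory Filter Topology InnerProductSpace Function Metric
open scoped RealInnerProductSpace NNReal ENNReal ContDiff
open Literature.Analysis Literature.Analysis.FluidPDE
open Summit.NavierStokesRegularity.NavierStokesRegularity.Theorems.PolyhedralDssProfileExists.PolyhedralCell
  (sqrt_mul_norm_heatExtension_le_of_norm_le_div)

/-! ### The uniform weak-`L³` bound of a Type-I field -/

/-- **A pointwise Type-I field is uniformly in weak-`L³`**: if `‖v(t, x)‖ ≤ K₀/(‖x‖ + √(−t))` on the
past, then `s³ · vol{x : s < ‖v(t, x)‖} ≤ K₀³ · vol B₁` for every `t < 0` and `s > 0`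
(`s < K₀/(‖x‖ + √(−t))` forces `‖x‖ < K₀/s`, and `vol B_{K₀/s} = (K₀/s)³ vol B₁`). -/
theorem farField_weakL3_of_hasTypeIDecay
    {v : ℝ → EuclideanSpace ℝ (Fin 3) → EuclideanSpace ℝ (Fin 3)} {K₀ : ℝ} (hdec : HasTypeIDecay K₀ v)
    {t : ℝ} (ht : t < 0) {s : ℝ} (hs : 0 < s) :
    ENNReal.ofReal s ^ 3 * volume {x : EuclideanSpace ℝ (Fin 3) | s < ‖v t x‖} ≤
      ENNReal.ofReal (K₀ ^ 3) * volume (ball (0 : EuclideanSpace ℝ (Fin 3)) 1) := by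
  -- adapted from `stub_noLargeScaleNullSlice` (QuantisedSymmetry…StubNoLargeScaleNullSlice.lean), Step 3
  have hK0 : 0 ≤ K₀ := hardness_typeI_const_nonneg hdec
  have hsub : {x : EuclideanSpace ℝ (Fin 3) | s < ‖v t x‖} ⊆ ball 0 (K₀ / s) := fun x hx => by
    rw [mem_ball_zero_iff, lt_div_iff₀ hs]
    have hD : 0 < ‖x‖ + Real.sqrt (-t) :=
      add_pos_of_nonneg_of_pos (norm_nonneg _) (Real.sqrt_pos.2 (neg_pos.2 ht))
    have h2 : s < K₀ / (‖x‖ + Real.sqrt (-t)) := lt_of_lt_of_le hx (hdec t ht x)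
    rw [lt_div_iff₀ hD] at h2
    nlinarith [Real.sqrt_nonneg (-t), norm_nonneg x]
  calc ENNReal.ofReal s ^ 3 * volume {x : EuclideanSpace ℝ (Fin 3) | s < ‖v t x‖}
      ≤ ENNReal.ofReal s ^ 3 * volume (ball (0 : EuclideanSpace ℝ (Fin 3)) (K₀ / s)) := by gcongr
    _ = ENNReal.ofReal (K₀ ^ 3) * volume (ball (0 : EuclideanSpace ℝ (Fin 3)) 1) := by
        rw [Measure.addHaar_ball volume _ (div_nonneg hK0 hs.le),
          finrank_euclideanSpace_fin, ← mul_assoc, ← ENNReal.ofReal_pow hs.le,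
          ← ENNReal.ofReal_mul (by positivity), ← mul_pow, mul_div_cancel₀ _ hs.ne']

/-! ### The far-field rung for physical fields -/

/-- **The far-field rung, physical form** (Albritton–Barker 2019, Thm 4.1 with `ε = 0`, on the
pointwise Type-I class). Let `(v, q)` be a classical unforced Navier–Stokes solution (`ν = 1`) on
`(−∞, 0) × ℝ³` which is bounded there and has the pointwise Type-I bound
`‖v(t, x)‖ ≤ K₀/(‖x‖ + √(−t))`. If at some `t₀ < 0` the Navier–Stokes blow-downs `λ v(t₀)(λ ·)` tend
to `0` in `𝒟'` as `λ → +∞`, then `v(t, ·) ≡ 0` for every `t ≤ t₀`. The field is in the bounded Oseen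
integral-equation class (KNSS 2009, Thm 6.1, mildness clause, on the windows `(s − 1, 0)`), it is
uniformly in weak-`L³` (`farField_weakL3_of_hasTypeIDecay`, along `τ_k = −k − 1`), and the final
slice obeys `√σ ‖e^{σΔ}v(t₀)‖_∞ ≤ A` (`sqrt_mul_norm_heatExtension_le_of_norm_le_div`, from
`‖v(t₀, z)‖ ≤ K₀/‖z‖`); the tree theorem `AlbrittonBarker2019_liouville_weakL3_backward_holds`
concludes. -/
theorem farField_liouville_physical
    {v : ℝ → EuclideanSpace ℝ (Fin 3) → EuclideanSpace ℝ (Fin 3)} {q : ℝ → EuclideanSpace ℝ (Fin 3) → ℝ}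
    (hcl : IsClassicalNSSolutionOn (Iio 0) 1 0 v q) {K₀ : ℝ} (hdec : HasTypeIDecay K₀ v)
    (hbdd : IsBoundedOn (Iio 0) v) {t₀ : ℝ} (ht₀ : t₀ < 0)
    (hzoom : ∀ φ : EuclideanSpace ℝ (Fin 3) → EuclideanSpace ℝ (Fin 3),
      Literature.Analysis.FunctionSpaces.IsTestFunctionOn
          (⊤ : TopologicalSpace.Opens (EuclideanSpace ℝ (Fin 3))) φ →
        Tendsto (fun lam : ℝ => ∫ x, ⟪lam • v t₀ (lam • x), φ x⟫) atTop (𝓝 0)) :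
    ∀ t ≤ t₀, ∀ x, v t x = 0 := by
  obtain ⟨C, hC⟩ := hbdd
  have hK0 : 0 ≤ K₀ := hardness_typeI_const_nonneg hdec
  -- (1) continuity on the open slab
  have hcont : ContinuousOn (uncurry v) (Iio 0 ×ˢ univ) := hcl.smooth_velocity.continuousOn
  -- (2) boundedness
  have hbdd' : ∃ C : ℝ, ∀ t < 0, ∀ x, ‖v t x‖ ≤ C := ⟨C, fun t ht x => hC t ht x⟩
  -- (3) weakly divergence-free slices
  have hwdiv : ∀ t < 0, IsWeaklyDivFree (v t) := fun t ht =>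
    VectorCalculus.IsDivFree.isWeaklyDivFree_holds (hcl.divFree t ht)
      ((hcl.contDiff_velocity ht).of_le (by norm_cast))
  -- (4) the Oseen identity between all pairs of negative times (KNSS 2009, Thm 6.1, mildness clause)
  have hmild : ∀ s t : ℝ, s < t → t < 0 → ∀ x,
      v t x = UnboundedOperators.heatExtension (v s) (t - s) x - oseenDuhamel 1 s v v t x := by
    intro s t hst ht x
    have hwin : IsClassicalNSSolutionOn (Ioo (s - 1) 0) 1 0 v q :=
      hcl.mono (fun r hr => hr.2) (uniqueDiffOn_Ioo _ _)
    have hL : ∃ L : ℝ, ∀ r ∈ Ioc (s - 1) t, ∀ x, ‖v r x‖ ≤ L :=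
      ⟨C, fun r hr x => hC r (hr.2.trans_lt ht) x⟩
    have hD : ∃ D : ℝ, ∀ r ∈ Ioc (s - 1) t, ∀ x, cylRadius x * ‖v r x‖ ≤ D :=
      ⟨K₀, fun r hr x => reduction_cylRadius_mul_norm_le hdec r (hr.2.trans_lt ht) x⟩
    exact KNSS2009_mild_of_rMulNorm_bounded_holds hwin (by linarith) ht hL hD (by linarith) hst le_rfl x
  -- (5) the uniform weak-`L³` bound along `τ_k = -k - 1 → -∞`
  have hweak : ∃ (τ : ℕ → ℝ) (M : ℝ≥0∞), M < ⊤ ∧ Tendsto τ atTop atBot ∧ (∀ k, τ k < 0) ∧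
      ∀ (k : ℕ) (s : ℝ), 0 < s →
        ENNReal.ofReal s ^ 3 * volume {x : EuclideanSpace ℝ (Fin 3) | s < ‖v (τ k) x‖} ≤ M := by
    refine ⟨fun k => -(k : ℝ) - 1,
      ENNReal.ofReal (K₀ ^ 3) * volume (ball (0 : EuclideanSpace ℝ (Fin 3)) 1),
      ENNReal.mul_lt_top ENNReal.ofReal_lt_top measure_ball_lt_top, ?_,
      fun k => by linarith [(k.cast_nonneg : (0 : ℝ) ≤ k)], fun k s hs => ?_⟩
    · refine tendsto_atTop_atBot.2 fun b => ?_
      obtain ⟨n, hn⟩ := exists_nat_ge (-b)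
      exact ⟨n, fun m hm => by
        have h : (n : ℝ) ≤ m := Nat.cast_le.2 hm
        linarith⟩
    · exact farField_weakL3_of_hasTypeIDecay hdec (by linarith [(k.cast_nonneg : (0 : ℝ) ≤ k)]) hs
  -- (6) the heat-kernel bound of the final slice, from `‖v(t₀, z)‖ ≤ K₀/‖z‖`
  have hgz : ∀ z : EuclideanSpace ℝ (Fin 3), z ≠ 0 → ‖v t₀ z‖ ≤ K₀ / ‖z‖ := fun z hz =>
    (hdec t₀ ht₀ z).trans (div_le_div_of_nonneg_left hK0 (norm_pos_iff.2 hz)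
      (le_add_of_nonneg_right (Real.sqrt_nonneg _)))
  have hheat : ∃ A : ℝ, ∀ σ : ℝ, 0 < σ → ∀ x,
      Real.sqrt σ * ‖UnboundedOperators.heatExtension (v t₀) σ x‖ ≤ A :=
    ⟨_, fun σ hσ x => sqrt_mul_norm_heatExtension_le_of_norm_le_div (v t₀) hK0 hgz hσ x⟩
  -- (7) Albritton–Barker 2019, Thm 4.1 (`ε = 0`)
  exact AlbrittonBarker2019_liouville_weakL3_backward_holds hcont hbdd' hwdiv hmild hweak ht₀ hheat hzoom

/-! ### The registered stub -/

/-- **Stub `stub_farFieldTransfer` (the far-field rung; Albritton–Barker 2019, Thm 4.1, `ε = 0`).**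
For an eternal classical solution `(W, Q)` of Leray's backward system on `ℝ × ℝ³` in the uniform
profile class `(1 + ‖y‖)^{k+1}‖DᵏW(s)‖ ≤ K_k`: if ONE slice `W(s₀)` has trivial blow-down at spatial
infinity (`∫ ⟪λ W(s₀)(λy), φ(y)⟫ dy → 0` as `λ → +∞` for every smooth compactly supported field `φ`),
then `W ≡ 0`. Proof: the past shift `v(t) = ofLerayOrbit W (t − τ)`, `τ = e^{−s₀}/2`, of the
physical field is a bounded classical solution on `(−∞, 0)` with the pointwise Type-I bound (constant
`K₀`), and its slice `v(−τ) = a⁻¹ • W(s₀)(a⁻¹ •  ·)`, `a = e^{−s₀/2}`, has trivial blow-down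
(reparametrise `λ ↦ λ a⁻¹`); `farField_liouville_physical` kills `v` for `t ≤ −τ`, i.e. `W(s) ≡ 0`
for `s ≤ s₀`, and `stub_forwardVanishing` (forward uniqueness from a zero past) gives `W ≡ 0`. -/
theorem stub_farFieldTransfer :
    ∀ (W : ℝ → EuclideanSpace ℝ (Fin 3) → EuclideanSpace ℝ (Fin 3)) (Q : ℝ → EuclideanSpace ℝ (Fin 3) → ℝ),
      IsBackwardLeraySolutionOn univ 1 W Q →
      (∀ k : ℕ, ∃ K : ℝ, ∀ s y, (1 + ‖y‖) ^ (k + 1) * ‖iteratedFDeriv ℝ k (W s) y‖ ≤ K) →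
      (∃ s₀ : ℝ, ∀ φ : EuclideanSpace ℝ (Fin 3) → EuclideanSpace ℝ (Fin 3),
        Literature.Analysis.FunctionSpaces.IsTestFunctionOn
            (⊤ : TopologicalSpace.Opens (EuclideanSpace ℝ (Fin 3))) φ →
          Tendsto (fun lam : ℝ => ∫ y, ⟪lam • W s₀ (lam • y), φ y⟫) atTop (𝓝 0)) →
      ∀ s y, W s y = 0 := by
  intro W Q hW hprof hblow
  obtain ⟨s₀, hblow⟩ := hblow
  obtain ⟨K₀, hK₀'⟩ := hprof 0
  have hK₀ : ∀ s y, (1 + ‖y‖) * ‖W s y‖ ≤ K₀ := fun s y => by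
    have h := hK₀' s y
    rwa [zero_add, pow_one, norm_iteratedFDeriv_zero] at h
  -- the pointwise Type-I bound of the physical field, with the `k = 0` profile constant
  have hdec : HasTypeIDecay K₀ (ofLerayOrbit W) := by
    refine hasTypeIDecay_iff_lerayOrbit.2 fun s y => ?_
    rw [lerayOrbit_ofLerayOrbit_eq]
    exact hK₀ s y
  -- the lag `τ = e^{-s₀}/2` and the shifted physical field `v(t) = ofLerayOrbit W (t - τ)`
  set τ : ℝ := Real.exp (-s₀) / 2 with hτ_def
  have hτ : 0 < τ := by positivity
  have hτ0 : -τ < 0 := neg_neg_of_pos hτ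
  have hcl := pastShift_isClassicalNSSolutionOn hW hτ
  have hdecv : HasTypeIDecay K₀ (fun t => ofLerayOrbit W (t + -τ)) :=
    hardness_hasTypeIDecay_translate hdec hτ.le
  have hbddv : IsBoundedOn (Iio 0) (fun t => ofLerayOrbit W (t + -τ)) :=
    hardness_isBoundedOn_translate hdec hτ
  -- the slice at `t₀ = -τ` is `a⁻¹ • W s₀ (a⁻¹ • ·)`, `a = e^{-s₀/2}`
  have hslice : ∀ x, ofLerayOrbit W (-τ + -τ) x =
      (Real.exp (-s₀ / 2))⁻¹ • W s₀ ((Real.exp (-s₀ / 2))⁻¹ • x) := fun x => by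
    rw [show -τ + -τ = -Real.exp (-s₀) by rw [hτ_def]; ring, ofLerayOrbit_apply, neg_neg,
      sqrt_exp_neg, neg_log_exp_neg]
  -- its blow-down is trivial: reparametrise `λ ↦ λ a⁻¹ → +∞`
  have hzoomv : ∀ φ : EuclideanSpace ℝ (Fin 3) → EuclideanSpace ℝ (Fin 3),
      Literature.Analysis.FunctionSpaces.IsTestFunctionOn
          (⊤ : TopologicalSpace.Opens (EuclideanSpace ℝ (Fin 3))) φ →
        Tendsto (fun lam : ℝ => ∫ x, ⟪lam • (fun t => ofLerayOrbit W (t + -τ)) (-τ) (lam • x), φ x⟫)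
          atTop (𝓝 0) := by
    intro φ hφ
    have ha : 0 < (Real.exp (-s₀ / 2))⁻¹ := inv_pos.2 (Real.exp_pos _)
    have hfun : (fun lam : ℝ => ∫ x, ⟪lam • (fun t => ofLerayOrbit W (t + -τ)) (-τ) (lam • x), φ x⟫) =
        (fun μ : ℝ => ∫ x, ⟪μ • W s₀ (μ • x), φ x⟫) ∘ fun lam : ℝ => id lam * (Real.exp (-s₀ / 2))⁻¹ := by
      funext lam
      simp only [Function.comp_apply, id, hslice, smul_smul, mul_comm ((Real.exp (-s₀ / 2))⁻¹) lam]
    rw [hfun]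
    exact (hblow φ hφ).comp (tendsto_id.atTop_mul_const ha)
  -- the far-field rung kills the shifted field up to `t₀ = -τ`
  have key := farField_liouville_physical hcl hdecv hbddv hτ0 hzoomv
  -- back to similarity variables: `W(s) ≡ 0` for `s ≤ s₀`
  have hpast : ∀ s ≤ s₀, ∀ y, W s y = 0 := by
    intro s hs y
    have hts : -Real.exp (-s) + τ ≤ -τ := by
      have h := Real.exp_le_exp.2 (neg_le_neg hs)
      rw [hτ_def]
      linarith
    have h0 : ofLerayOrbit W (-Real.exp (-s) + τ + -τ) (Real.exp (-s / 2) • y) = 0 :=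
      key _ hts _
    rw [show -Real.exp (-s) + τ + -τ = -Real.exp (-s) by ring] at h0
    have e : W s y = lerayOrbit (ofLerayOrbit W) s y := by rw [lerayOrbit_ofLerayOrbit_eq]
    rw [e, lerayOrbit_apply, h0, smul_zero]
  exact stub_forwardVanishing W Q hW hprof s₀ hpast

end Summit.NavierStokesRegularity.NavierStokesRegularity.Theorems.NoSelfExcitedDynamo.Registered

end
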